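import Literature.MathematicalPhysics.QuantumFieldTheory.Balaban1983to89.B9Thm312WholeRightStepFrom3131

/-!
# `Balaban1983to89.B9Thm312WholeDirB` — [B9] Theorem 3.12 (pp. 421–423): THE DIRECTION-INDEXED PERTURBATION-STEP SCHEMA WITH β- AND
# ε-INDEXED CONSTANTS (`StepDirB`, the print-faithful reshape of `B9Thm312WholeDir.StepDir` — located remarks U2 ∕ U3, referee
# WATCH-A6-N06-STEPDIR-EPSUNIFORM) AND ITS DERIVATION FROM THEOREM 3.3 FOR G₀ AND THE (3.131) ∕ (3.137) LETTERS WITH NO UNIFORMITY HYPOTHESIS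

T. Bałaban, *Propagators for lattice gauge theories in a background field*, Commun. Math. Phys. **99** (1985) 389–434
[`Balaban1985BackgroundPropagators`, "B9"]; [4] = T. Bałaban, *Propagators and renormalization transformations for lattice gauge
theories. II*, Commun. Math. Phys. **96** (1984) 223–250 [`Balaban1984PropagatorsII`].

statement-level skeleton of published theorems with citation tags; proofs where landed; nothing here is a claim about the Yang–Mills
mass gap

THE POINT.  `StepDir` (g6) carries ONE constant θ_H for all Hölder exponents β ∈ [0,1) of its probe members and all input exponents ε > 0 of its
right-form members, whereas print's constants B₀(β), B′₀(ε) of Theorem 3.1 ∕ 3.3 *"→ ∞ if β → 1"*, *"→ ∞ if ε → 0"* (pp. 397–398); the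
derivations `B9Thm312WholeStepDirFrom3131.stepDir_of_letters3131` ∕ `B9Thm312WholeRightStepFrom3131.stepDir_of_letters3131LR` therefore had to
display β∕ε-UNIFORM domination hypotheses (finite-lattice-true, print-unfaithful).  THIS FILE registers the β∕ε-INDEXED twin `StepDirB 𝔬 𝔭 Dd Dds
R₀ H₀ bHX hlen θD θH θI δK U` (θ_H : ℝ → ℝ on the probe members at β, θ_I : ℝ → ℝ on the right-form members at ε; everything else VERBATIM
`StepDir`) and proves ★★ `stepDirB_of_letters3131LR` from the same letters with the constants AS FUNCTIONS — θ_H(β) = 2·max-free sums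
2(B_h(β) + κ_H·B_hD(β))tc etc. are now hypotheses `hθH1–3` POINTWISE IN β and `hθI` POINTWISE IN ε, satisfiable with print's β∕ε-dependent
constants.  `stepDir_of_stepDirB` recovers the registered `StepDir` under uniform bounds (the consumer's «constants by choice»).  The B-twins of
the blocks ∕ leaf (`…BlocksPairMB`, `…LeafCompletePairMB`) are the sequel.  COUNT-NEUTRAL; N06 is NOT discharged; one finite lattice at a time;
nothing continuum, nothing about the mass gap.  Cell `pub-ymgap` (HUMAN RULING D-0062), Track A node N06 [B9], N06-ASSIGNMENT v1 rows 20–21 (bundle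
F7), seat `pub-ymgap-dag-n06-l` (g12), 2026-08-27.
-/

namespace Literature.MathematicalPhysics.QuantumFieldTheory.Balaban1983to89.B9Thm312WholeDirB

open Literature.MathematicalPhysics.QuantumFieldTheory.Balaban1983to89
open Finset B6RandomWalk B6RandomWalkHom B9Thm34Ext B11SectG B9SectDSup B9Thm312Whole B9Thm312WholeLeaf B9Thm312WholeClasses
open B9RWSums343Holder B9RWSums343to347Whole B9RWSums346Schur B9Thm312WholeDir B9Thm313WholeHolder B9Thm313WholeDir
open B9Thm312WholeStepFrom3131 B9Thm312WholeLeftStepFrom3131 B9Thm312WholeStepDirFrom3131 B9Thm312WholeRightStepFrom3131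

noncomputable section

variable {g : B9.Geometry} {B : B9.Backgrounds} {X Y Z W PX PY P : Type}
variable [Fintype X] [Fintype Y] [Fintype Z] [Fintype W] [Fintype PX] [Fintype PY] [Fintype P] [Fintype g.Site]
variable {R₀ : ℝ} {H₀ : Prop}

/-! ## §1 The schema with β- and ε-indexed constants (printed type; nothing asserted) -/

/-- **THE PERTURBATION STEPS OF (3.130) ∕ (3.138), DIRECTION-INDEXED, WITH β-INDEXED PROBE CONSTANTS AND ε-INDEXED INPUT CONSTANTS** — verbatim
`B9Thm312WholeDir.StepDir` except that the probe members `pY pY1 pX pX1 pXd pXd1` carry θ_H(β) and the right-form members `tDd tDd1` carry θ_I(ε)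
(print: the Hölder constants B₀(β) and the input constants B′₀(ε) of Theorems 3.1 ∕ 3.3 depend on β resp. ε, pp. 397–398; the step inherits
them through its first ∕ last factor, p. 423).  A HYPOTHESIS SCHEMA; nothing asserted.
[cite: Balaban1985BackgroundPropagators, (3.130)–(3.131) pp.421–422 + (3.137)–(3.138) p.423 + (3.42)–(3.45) pp.397–398 + (3.39) p.397] -/
structure StepDirB (𝔬 : Ops g B X Y Z W) (𝔭 : HolderProbes g B X Y PX PY) (Dd Dds : B.Cfg → P → Module.End ℝ (X → ℝ))
    (R₀ : ℝ) (H₀ : Prop) (bHX : ℝ → BlockNorm (toB6 g R₀ H₀) (X → ℝ)) (hlen : ∀ y : g.Site, 0 ≤ g.len y) (θD : ℝ)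
    (θH θI : ℝ → ℝ) (δK : ℝ) (U : B.Cfg) : Prop where
  pY : ∀ β : ℝ, 0 ≤ β → β < 1 → HasMaj (cNormR R₀ H₀ 𝔬.blk hlen (-2)) (cNormR R₀ H₀ 𝔭.blkPY hlen (β - 1))
    ((𝔭.ΦY U β ∘ₗ 𝔬.D U ∘ₗ 𝔬.G0 U) ∘ₗ 𝔬.Tpi U) (fun a b => θH β * Real.exp (-(δK * g.dist a b)))
  pY1 : ∀ β : ℝ, 0 ≤ β → β < 1 → HasMaj (cNormR R₀ H₀ 𝔬.blk hlen (-2)) (cNormR R₀ H₀ 𝔭.blkPY hlen (β - 1))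
    ((𝔭.ΦY U β ∘ₗ 𝔬.D U ∘ₗ 𝔬.G0 U) ∘ₗ (𝔬.Tpi U + 𝔬.T2 U)) (fun a b => θH β * Real.exp (-(δK * g.dist a b)))
  pX : ∀ β : ℝ, 0 ≤ β → β < 1 → HasMaj (cNormR R₀ H₀ 𝔬.blk hlen (-1)) (cNormR R₀ H₀ 𝔭.blkPX hlen (β - 1))
    ((𝔭.ΦX U β ∘ₗ 𝔬.G0 U) ∘ₗ 𝔬.Tpi U) (fun a b => θH β * Real.exp (-(δK * g.dist a b)))
  pX1 : ∀ β : ℝ, 0 ≤ β → β < 1 → HasMaj (cNormR R₀ H₀ 𝔬.blk hlen (-1)) (cNormR R₀ H₀ 𝔭.blkPX hlen (β - 1))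
    ((𝔭.ΦX U β ∘ₗ 𝔬.G0 U) ∘ₗ (𝔬.Tpi U + 𝔬.T2 U)) (fun a b => θH β * Real.exp (-(δK * g.dist a b)))
  sDd : ∀ ν : P, HasMaj (cNorm R₀ H₀ 𝔬.blk hlen 2) (cNorm R₀ H₀ 𝔬.blk hlen 1) (Dd U ν ∘ₗ 𝔬.G0 U ∘ₗ 𝔬.Tpi U)
    (fun a b => θD * Real.exp (-(δK * g.dist a b)))
  sDd1 : ∀ ν : P, HasMaj (cNorm R₀ H₀ 𝔬.blk hlen 2) (cNorm R₀ H₀ 𝔬.blk hlen 1) (Dd U ν ∘ₗ 𝔬.G0 U ∘ₗ (𝔬.Tpi U + 𝔬.T2 U))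
    (fun a b => θD * Real.exp (-(δK * g.dist a b)))
  pXd : ∀ (ν : P) (β : ℝ), 0 ≤ β → β < 1 → HasMaj (cNormR R₀ H₀ 𝔬.blk hlen (-2)) (cNormR R₀ H₀ 𝔭.blkPX hlen (β - 1))
    ((𝔭.ΦX U β ∘ₗ Dd U ν ∘ₗ 𝔬.G0 U) ∘ₗ 𝔬.Tpi U) (fun a b => θH β * Real.exp (-(δK * g.dist a b)))
  pXd1 : ∀ (ν : P) (β : ℝ), 0 ≤ β → β < 1 → HasMaj (cNormR R₀ H₀ 𝔬.blk hlen (-2)) (cNormR R₀ H₀ 𝔭.blkPX hlen (β - 1))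
    ((𝔭.ΦX U β ∘ₗ Dd U ν ∘ₗ 𝔬.G0 U) ∘ₗ (𝔬.Tpi U + 𝔬.T2 U)) (fun a b => θH β * Real.exp (-(δK * g.dist a b)))
  tDd : ∀ (μ : P) (ε : ℝ), 0 < ε → HasMaj (bHX ε) (cNormR R₀ H₀ 𝔬.blk hlen 1) (𝔬.Tpi U ∘ₗ (𝔬.G0 U ∘ₗ Dds U μ))
    (fun a b => θI ε * Real.exp (-(δK * g.dist a b)))
  tDd1 : ∀ (μ : P) (ε : ℝ), 0 < ε → HasMaj (bHX ε) (cNormR R₀ H₀ 𝔬.blk hlen 1) ((𝔬.Tpi U + 𝔬.T2 U) ∘ₗ (𝔬.G0 U ∘ₗ Dds U μ))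
    (fun a b => θI ε * Real.exp (-(δK * g.dist a b)))

/-! ## §2 The registered one-constant schema from the indexed one under uniform bounds; the converse -/

omit [Fintype Z] [Fintype W] in
/-- Kernel monotonicity in the constant. [folklore] -/
private theorem maj_mono_const {F₁ F₂ : Type} [AddCommGroup F₁] [Module ℝ F₁] [AddCommGroup F₂] [Module ℝ F₂]
    {b₁ : BlockNorm (toB6 g R₀ H₀) F₁} {b₂ : BlockNorm (toB6 g R₀ H₀) F₂} {T : F₁ →ₗ[ℝ] F₂} {C C' δK : ℝ} (hCC' : C ≤ C')
    (h : HasMaj b₁ b₂ T (fun a b => C * Real.exp (-(δK * g.dist a b)))) :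
    HasMaj b₁ b₂ T (fun a b => C' * Real.exp (-(δK * g.dist a b))) :=
  h.mono fun _ _ => mul_le_mul_of_nonneg_right hCC' (Real.exp_nonneg _)

omit [Fintype Y] [Fintype Z] [Fintype W] [Fintype P] in
/-- **THE REGISTERED SCHEMA FROM THE INDEXED ONE UNDER UNIFORM BOUNDS** («constants by choice»): if θ_H(β) ≦ θ_H* for all β ∈ [0,1) and θ_I(ε) ≦ θ_H*
for all ε > 0, then `StepDirB … θD θH θI δK U` gives `StepDir … θD θ_H* δK U`.
[cite: Balaban1985BackgroundPropagators, Thm 3.12 p.423 (bookkeeping)] -/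
theorem stepDir_of_stepDirB {𝔬 : Ops g B X Y Z W} {𝔭 : HolderProbes g B X Y PX PY} {Dd Dds : B.Cfg → P → Module.End ℝ (X → ℝ)}
    {bHX : ℝ → BlockNorm (toB6 g R₀ H₀) (X → ℝ)} {hlen : ∀ y : g.Site, 0 ≤ g.len y} {θD θHu δK : ℝ} {θH θI : ℝ → ℝ} {U : B.Cfg}
    (hH : ∀ β : ℝ, 0 ≤ β → β < 1 → θH β ≤ θHu) (hI : ∀ ε : ℝ, 0 < ε → θI ε ≤ θHu)
    (h : StepDirB 𝔬 𝔭 Dd Dds R₀ H₀ bHX hlen θD θH θI δK U) : StepDir 𝔬 𝔭 Dd Dds R₀ H₀ bHX hlen θD θHu δK U where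
  pY β h0 h1 := maj_mono_const (hH β h0 h1) (h.pY β h0 h1)
  pY1 β h0 h1 := maj_mono_const (hH β h0 h1) (h.pY1 β h0 h1)
  pX β h0 h1 := maj_mono_const (hH β h0 h1) (h.pX β h0 h1)
  pX1 β h0 h1 := maj_mono_const (hH β h0 h1) (h.pX1 β h0 h1)
  sDd := h.sDd
  sDd1 := h.sDd1
  pXd ν β h0 h1 := maj_mono_const (hH β h0 h1) (h.pXd ν β h0 h1)
  pXd1 ν β h0 h1 := maj_mono_const (hH β h0 h1) (h.pXd1 ν β h0 h1)
  tDd μ ε hε := maj_mono_const (hI ε hε) (h.tDd μ ε hε)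
  tDd1 μ ε hε := maj_mono_const (hI ε hε) (h.tDd1 μ ε hε)

omit [Fintype Y] [Fintype Z] [Fintype W] [Fintype P] in
/-- The converse embedding: the registered one-constant schema is the indexed one at constant functions.
[cite: Balaban1985BackgroundPropagators, Thm 3.12 p.423 (bookkeeping)] -/
theorem stepDirB_of_stepDir {𝔬 : Ops g B X Y Z W} {𝔭 : HolderProbes g B X Y PX PY} {Dd Dds : B.Cfg → P → Module.End ℝ (X → ℝ)}
    {bHX : ℝ → BlockNorm (toB6 g R₀ H₀) (X → ℝ)} {hlen : ∀ y : g.Site, 0 ≤ g.len y} {θD θH δK : ℝ} {U : B.Cfg}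
    (h : StepDir 𝔬 𝔭 Dd Dds R₀ H₀ bHX hlen θD θH δK U) : StepDirB 𝔬 𝔭 Dd Dds R₀ H₀ bHX hlen θD (fun _ => θH) (fun _ => θH) δK U :=
  ⟨h.pY, h.pY1, h.pX, h.pX1, h.sDd, h.sDd1, h.pXd, h.pXd1, h.tDd, h.tDd1⟩

/-! ## §3 The indexed schema from Theorem 3.3 for G₀ and the letters — no uniformity hypothesis -/

omit [Fintype Y] [Fintype Z] [Fintype W] [Fintype PX] [Fintype PY] [Fintype P] [Fintype X] [Fintype g.Site] in
/-- Kernel monotonicity: C·e^{−rd} ≦ θ·e^{−δ_K d} for 0 ≦ C ≦ θ, δ_K ≦ r, d ≧ 0. [folklore] -/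
private theorem kernel_le₄ {C θ r δK d : ℝ} (hC : 0 ≤ C) (hCθ : C ≤ θ) (hδK : δK ≤ r) (hd : 0 ≤ d) :
    C * Real.exp (-(r * d)) ≤ θ * Real.exp (-(δK * d)) :=
  calc C * Real.exp (-(r * d)) ≤ C * Real.exp (-(δK * d)) :=
      mul_le_mul_of_nonneg_left (Real.exp_le_exp.mpr (neg_le_neg (mul_le_mul_of_nonneg_right hδK hd))) hC
    _ ≤ θ * Real.exp (-(δK * d)) := mul_le_mul_of_nonneg_right hCθ (Real.exp_nonneg _)

omit [Fintype Y] [Fintype P] in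
/-- ★★ **THE β∕ε-INDEXED STEP SCHEMA OF ROWS 20–21 FROM THEOREM 3.3 FOR G₀ AND THE LETTERS — NO UNIFORMITY HYPOTHESIS** (the print-faithful form
of `stepDir_of_letters3131LR`; resolves located remarks U2 ∕ U3 and referee WATCH-A6-N06-STEPDIR-EPSUNIFORM at the schema level): `StepDirB 𝔬 𝔭 Dd
Dds R₀ H₀ bHX hlen θD θH θI δK U` from `Thm33G0Dir` + `Thm33G0DirR`, `Letters313H`, `Letters313DM`, `Thm33G0DirX`, `Thm33G0DivR`, the input-norm
domination `domX ∕ locX`, `Letters3131`, `Letters3131H`, `Letters3131R`, the row sum and `Facts347`, for θ_D ≧ 2(B₀ + κ_H·B₃)tc and — POINTWISE —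
θ_H(β) ≧ 2(B_h(β) + κ_H·B_hD(β))tc, 2(B_h(β) + κ_H·B_dX(β))tc, 2(B_x0(β) + B_x(β))tcL₀ for each β ∈ [0,1) and θ_I(ε) ≧ 2(B₀L₀ + B_iD(ε))tc for
each ε > 0 (e.g. θ_H := the sum of the three, θ_I(ε) := 2(B₀L₀ + B_iD(ε))tc); rates 0 ≦ δ_K, δ_K + αδ ≦ ρ ≦ δ_T, ρ + σ ≦ min(δ₀, δ₃).
[cite: Balaban1985BackgroundPropagators, Thm 3.12 p.423 + (3.130)–(3.131) pp.421–422 + (3.137)–(3.138) p.423 + Thm 3.3 p.399 + (3.42)–(3.45) pp.397–398 + p.398 (remarks after (3.47)); Balaban1984PropagatorsII, (2.26) p.228 + (2.54) p.233 + Lemma 2.1 (2.60)–(2.61) p.234] -/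
theorem stepDirB_of_letters3131LR (hG : GeoOK g) {𝔬 : Ops g B X Y Z W} {𝔭 : HolderProbes g B X Y PX PY}
    {Dd Dds : B.Cfg → P → Module.End ℝ (X → ℝ)} {bHX : ℝ → BlockNorm (toB6 g R₀ H₀) (X → ℝ)}
    {bHW : ℝ → BlockNorm (toB6 g R₀ H₀) (W → ℝ)} {bH : BlockNorm (toB6 g R₀ H₀) (W → ℝ)}
    {Ta Ta₂ : B.Cfg → Module.End ℝ (X → ℝ)} {Tb Tb₂ : B.Cfg → (X → ℝ) →ₗ[ℝ] (W → ℝ)}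
    {Ta' Ta₂' : B.Cfg → Module.End ℝ (X → ℝ)} {Tb' Tb₂' : B.Cfg → (W → ℝ) →ₗ[ℝ] (X → ℝ)}
    {U : B.Cfg} {d : ℕ} {δ α L₀ : ℝ} (hF : Facts347 g R₀ H₀ d δ α L₀)
    {B₀ B₃ t δ₀ δ₃ δT ρ σ c θD δK : ℝ} {θH θI Bh Bi : ℝ → ℝ} {Bi2 : ℝ → ℝ → ℝ} {BhD Bx Bq Bx0 BdX BiD BdD : ℝ → ℝ}
    (hrow : RowSum (toB6 g R₀ H₀) σ c) (hc : 0 ≤ c) (hB₀ : 0 ≤ B₀) (hB₃ : 0 ≤ B₃) (ht : 0 ≤ t)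
    (hBh : ∀ β : ℝ, 0 ≤ β → β < 1 → 0 ≤ Bh β) (hBhD : ∀ β : ℝ, 0 ≤ β → β < 1 → 0 ≤ BhD β)
    (hBx : ∀ β : ℝ, 0 ≤ β → β < 1 → 0 ≤ Bx β) (hBx0 : ∀ β : ℝ, 0 ≤ β → β < 1 → 0 ≤ Bx0 β)
    (hBdX : ∀ β : ℝ, 0 ≤ β → β < 1 → 0 ≤ BdX β) (hBiD : ∀ ε : ℝ, 0 < ε → 0 ≤ BiD ε)
    (hρT : ρ ≤ δT) (hρ₀ : ρ + σ ≤ δ₀) (hρ₃ : ρ + σ ≤ δ₃) (hαδ : 0 ≤ α * δ) (hδK0 : 0 ≤ δK) (hδK : δK + α * δ ≤ ρ)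
    (hθD : 2 * ((B₀ + bH.κ * B₃) * t * c) ≤ θD)
    (hθH1 : ∀ β : ℝ, 0 ≤ β → β < 1 → 2 * ((Bh β + bH.κ * BhD β) * t * c) ≤ θH β)
    (hθH2 : ∀ β : ℝ, 0 ≤ β → β < 1 → 2 * ((Bh β + bH.κ * BdX β) * t * c) ≤ θH β)
    (hθH3 : ∀ β : ℝ, 0 ≤ β → β < 1 → 2 * ((Bx0 β + Bx β) * t * c * L₀) ≤ θH β)
    (hθI : ∀ ε : ℝ, 0 < ε → 2 * ((B₀ * L₀ + BiD ε) * t * c) ≤ θI ε)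
    (h33 : Thm33G0Dir 𝔬 𝔭 Dd Dds R₀ H₀ bHX B₀ Bh Bi Bi2 δ₀ U) (h33R : Thm33G0DirR 𝔬 Dds R₀ H₀ B₀ δ₀ U)
    (hLH3 : Letters313H 𝔬 𝔭 R₀ H₀ hG.lenle bH BhD Bx δ₃ U)
    (hDM : Letters313DM 𝔬 𝔭 Dd R₀ H₀ hG B₃ Bq δ₃ bH U) (hX : Thm33G0DirX 𝔬 𝔭 Dd R₀ H₀ hG.lenle bH Bx0 BdX δ₀ δ₃ U)
    (hdiv : Thm33G0DivR 𝔬 Dds R₀ H₀ hG.lenle bHX bHW BiD BdD δ₀ δ₃ U)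
    (hdomX : ∀ ε : ℝ, 0 < ε → ∀ (y : g.Site) (μ : X → ℝ), (BlockNorm.ofBlocks (toB6 g R₀ H₀) 𝔬.blk).loc y μ ≤ (bHX ε).loc y μ)
    (hlocX : ∀ ε : ℝ, 0 < ε → ∀ (y : g.Site) (μ : X → ℝ), (bHX ε).IsLoc y μ → (BlockNorm.ofBlocks (toB6 g R₀ H₀) 𝔬.blk).IsLoc y μ)
    (hL : Letters3131 𝔬 Ta Ta₂ Tb Tb₂ R₀ H₀ hG.lenle t δT U) (hLH : Letters3131H 𝔬 Tb Tb₂ R₀ H₀ hG.lenle bH t δT U)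
    (hR : Letters3131R 𝔬 Ta' Ta₂' Tb' Tb₂' R₀ H₀ hG.lenle t δT U) :
    StepDirB 𝔬 𝔭 Dd Dds R₀ H₀ bHX hG.lenle θD θH θI δK U := by
  have hρ : 0 ≤ ρ := by linarith
  have hαρ : α * δ ≤ ρ := by linarith
  have hδKρ : δK ≤ ρ := by linarith
  have hδKρ' : δK ≤ ρ - α * δ := by linarith
  have hL₀ : 0 ≤ L₀ := le_trans (le_trans zero_le_one hF.one_le_L) hF.L_le
  -- the probe members E = Φ^Y_β∇_U, Φ^X_β∇_{U,ν} at β (pointwise θ_H(β))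
  have probe2 : ∀ {F : Type} [AddCommGroup F] [Module ℝ F] {bout : BlockNorm (toB6 g R₀ H₀) F} {EG : (X → ℝ) →ₗ[ℝ] F} {a aD θ : ℝ},
      0 ≤ a → 0 ≤ aD → 2 * ((a + bH.κ * aD) * t * c) ≤ θ →
      HasMaj (cNormR R₀ H₀ 𝔬.blk hG.lenle 0) bout EG (fun a' b => a * Real.exp (-(δ₀ * g.dist a' b))) →
      HasMaj bH bout (EG ∘ₗ 𝔬.Dv U) (fun a' b => aD * Real.exp (-(δ₃ * g.dist a' b))) →
      HasMaj (cNormR R₀ H₀ 𝔬.blk hG.lenle (-2)) bout (EG ∘ₗ 𝔬.Tpi U) (fun a' b => θ * Real.exp (-(δK * g.dist a' b))) ∧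
        HasMaj (cNormR R₀ H₀ 𝔬.blk hG.lenle (-2)) bout (EG ∘ₗ (𝔬.Tpi U + 𝔬.T2 U))
          (fun a' b => θ * Real.exp (-(δK * g.dist a' b))) := by
    intro F _ _ bout EG a aD θ ha haD hθ hE hED
    have hA := probeStep_of_split hG hrow ha haD ht hρ hρT hρ₀ hρ₃ hL.split hE hED hL.ta hLH.tbH
    have hB := probeStep_of_split hG hrow ha haD ht hρ hρT hρ₀ hρ₃ hL.split₂ hE hED hL.ta₂ hLH.tb₂H
    have hK : 0 ≤ (a + bH.κ * aD) * t * c := mul_nonneg (mul_nonneg (add_nonneg ha (mul_nonneg bH.κ_nonneg haD)) ht) hc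
    have hc1 : (a + bH.κ * aD) * t * c ≤ θ := by linarith
    refine ⟨hA.mono fun a' b => kernel_le₄ hK hc1 hδKρ (hG.dnn a' b), ((hA.add hB).congr fun μ => ?_).mono fun a' b => ?_⟩
    · simp only [LinearMap.add_apply, LinearMap.comp_apply, map_add]
    · calc (a + bH.κ * aD) * t * c * Real.exp (-(ρ * g.dist a' b)) + (a + bH.κ * aD) * t * c * Real.exp (-(ρ * g.dist a' b))
          = 2 * ((a + bH.κ * aD) * t * c) * Real.exp (-(ρ * g.dist a' b)) := by ring
        _ ≤ θ * Real.exp (-(δK * g.dist a' b)) := kernel_le₄ (mul_nonneg (by norm_num) hK) hθ hδKρ (hG.dnn a' b)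
  -- the Φ^X_β member of the step itself at β
  have probeX2 : ∀ β : ℝ, 0 ≤ β → β < 1 →
      HasMaj (cNormR R₀ H₀ 𝔬.blk hG.lenle (-1)) (cNormR R₀ H₀ 𝔭.blkPX hG.lenle (β - 1)) ((𝔭.ΦX U β ∘ₗ 𝔬.G0 U) ∘ₗ 𝔬.Tpi U)
          (fun a' b => θH β * Real.exp (-(δK * g.dist a' b))) ∧
        HasMaj (cNormR R₀ H₀ 𝔬.blk hG.lenle (-1)) (cNormR R₀ H₀ 𝔭.blkPX hG.lenle (β - 1))
          ((𝔭.ΦX U β ∘ₗ 𝔬.G0 U) ∘ₗ (𝔬.Tpi U + 𝔬.T2 U)) (fun a' b => θH β * Real.exp (-(δK * g.dist a' b))) := by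
    intro β hβ0 hβ1
    have hA := probeStepX_of_split hG hF hrow hc (hBx0 β hβ0 hβ1) (hBx β hβ0 hβ1) ht hαρ hαδ hρT hρ₀ hρ₃ hL.split
      (hX.pX0 β hβ0 hβ1) (hLH3.pXDv β hβ0 hβ1) hL.ta hL.tb
    have hB := probeStepX_of_split hG hF hrow hc (hBx0 β hβ0 hβ1) (hBx β hβ0 hβ1) ht hαρ hαδ hρT hρ₀ hρ₃ hL.split₂
      (hX.pX0 β hβ0 hβ1) (hLH3.pXDv β hβ0 hβ1) hL.ta₂ hL.tb₂
    have hK : 0 ≤ (Bx0 β + Bx β) * t * c * L₀ :=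
      mul_nonneg (mul_nonneg (mul_nonneg (add_nonneg (hBx0 β hβ0 hβ1) (hBx β hβ0 hβ1)) ht) hc) hL₀
    have hc1 : (Bx0 β + Bx β) * t * c * L₀ ≤ θH β := by linarith [hθH3 β hβ0 hβ1]
    refine ⟨hA.mono fun a' b => kernel_le₄ hK hc1 hδKρ' (hG.dnn a' b), ((hA.add hB).congr fun μ => ?_).mono fun a' b => ?_⟩
    · simp only [LinearMap.add_apply, LinearMap.comp_apply, map_add]
    · calc (Bx0 β + Bx β) * t * c * L₀ * Real.exp (-((ρ - α * δ) * g.dist a' b)) +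
            (Bx0 β + Bx β) * t * c * L₀ * Real.exp (-((ρ - α * δ) * g.dist a' b))
          = 2 * ((Bx0 β + Bx β) * t * c * L₀) * Real.exp (-((ρ - α * δ) * g.dist a' b)) := by ring
        _ ≤ θH β * Real.exp (-(δK * g.dist a' b)) := kernel_le₄ (mul_nonneg (by norm_num) hK) (hθH3 β hβ0 hβ1) hδKρ' (hG.dnn a' b)
  -- the right-form members at ε (pointwise θ_I(ε))
  have hright := fun (μ : P) (ε : ℝ) (hε : 0 < ε) =>
    tDd_of_letters3131R hG hF hrow hB₀ ht hBiD hαρ hαδ hρT hρ₀ h33R.e2d hdomX hlocX hdiv hR μ ε hε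
  have hKI : ∀ ε : ℝ, 0 < ε → 0 ≤ (B₀ * L₀ + BiD ε) * t * c := fun ε hε =>
    mul_nonneg (mul_nonneg (add_nonneg (mul_nonneg hB₀ hL₀) (hBiD ε hε)) ht) hc
  refine
    { pY := fun β hβ0 hβ1 => (probe2 (hBh β hβ0 hβ1) (hBhD β hβ0 hβ1) (hθH1 β hβ0 hβ1)
        (hasMaj_probe_cNormR_of_hom hG (hBh β hβ0 hβ1) (h33.h43L β hβ0 hβ1)) (hLH3.pYDH β hβ0 hβ1)).1
      pY1 := fun β hβ0 hβ1 => (probe2 (hBh β hβ0 hβ1) (hBhD β hβ0 hβ1) (hθH1 β hβ0 hβ1)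
        (hasMaj_probe_cNormR_of_hom hG (hBh β hβ0 hβ1) (h33.h43L β hβ0 hβ1)) (hLH3.pYDH β hβ0 hβ1)).2
      pX := fun β hβ0 hβ1 => (probeX2 β hβ0 hβ1).1
      pX1 := fun β hβ0 hβ1 => (probeX2 β hβ0 hβ1).2
      sDd := fun ν => (stepDd_of_letters3131 hG hrow hc hB₀ hB₃ ht hρ hρT hρ₀ hρ₃ hθD hδKρ h33.e1d hDM.dgDHd hL hLH ν).1
      sDd1 := fun ν => (stepDd_of_letters3131 hG hrow hc hB₀ hB₃ ht hρ hρT hρ₀ hρ₃ hθD hδKρ h33.e1d hDM.dgDHd hL hLH ν).2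
      pXd := fun ν β hβ0 hβ1 => (probe2 (hBh β hβ0 hβ1) (hBdX β hβ0 hβ1) (hθH2 β hβ0 hβ1)
        (hasMaj_probe_cNormR_of_hom hG (hBh β hβ0 hβ1) (h33.h43d ν β hβ0 hβ1)) (hX.pXdDH ν β hβ0 hβ1)).1
      pXd1 := fun ν β hβ0 hβ1 => (probe2 (hBh β hβ0 hβ1) (hBdX β hβ0 hβ1) (hθH2 β hβ0 hβ1)
        (hasMaj_probe_cNormR_of_hom hG (hBh β hβ0 hβ1) (h33.h43d ν β hβ0 hβ1)) (hX.pXdDH ν β hβ0 hβ1)).2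
      tDd := fun μ ε hε => by
        have hc1 : (B₀ * L₀ + BiD ε) * t * c ≤ θI ε := by linarith [hθI ε hε, hKI ε hε]
        exact (hright μ ε hε).1.mono fun a b => kernel_le₄ (hKI ε hε) hc1 hδKρ' (hG.dnn a b)
      tDd1 := fun μ ε hε =>
        (hright μ ε hε).2.mono fun a b => kernel_le₄ (mul_nonneg (by norm_num) (hKI ε hε)) (hθI ε hε) hδKρ' (hG.dnn a b) }

end

end Literature.MathematicalPhysics.QuantumFieldTheory.Balaban1983to89.B9Thm312WholeDirB
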